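import Summits.NavierStokesRegularity.NavierStokesRegularity.Theses.TypeICertificateLadder
import Literature.Analysis.FluidPDE.AxisymmetricTypeIAxis
import Literature.Analysis.FluidPDE.SereginSverakPressureLocalTypeI
import Literature.Barriers.NavierStokesRegularity.AxisymmetricTypeIExclusionProofs

/-!
# Route TypeICertificateLadder — crux `NoTypeIBlowup` (item stmt-NavierStokesRegularity-1217):
# the unit-cylinder zoom of a Type I classical solution at an arbitrary centre

Helper file (theorems only) towards the crux `NoTypeIBlowup` (symmetry-free Type I exclusion,
OPEN). For a classical solution `(u, p)` of Navier–Stokes (viscosity `ν > 0`) on `ℝ³ × [0, T)`,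
Leray–Hopf on `[0, T)`, with the eventual Type I rate `√(T − t)|u(t, x)| ≤ C` on a final window
`(T − δ, T)`, and for ANY top time `T' ∈ (T − δ/2, T]` and centre `x₁`, the viscosity-normalising
zoom about `(T', x₁)` at a FIXED scale `R` (`4R²/ν ≤ δ`), `w = α u ∘ Φ`, `π = α² q ∘ Φ`,
`G = αR ∇u ∘ Φ` (`Φ(s, y) = (T' + βs, x₁ + Ry)`, `α = R/ν`, `β = R²/ν`, `q` Tao's gauge of the
pressure), is a suitable weak solution of the unit-viscosity system in Seregin–Šverák's unit
cylinder `Q(0, 1) = 𝒞 × ]-1, 0[` with `w ∈ L³`, weak gradient `G`, the a.e. Type I bound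
`√(-s)|w| ≤ αC/√β`, and — the point — with the data `A(0, 3/4; w)`, `E(0, 3/4; G)`, `D(0, 1; π)`
of Lemma 3.5 bounded by expressions INDEPENDENT of `(T', x₁)` (global energy, global dissipation
and the slab `L^{3/2}` norm of the gauged pressure, times powers of the fixed scales).

* `exists_typeI_rate_window` — the eventual rate of `IsTypeIBlowup` on a final window;
* `zoom_unitCyl_data` — the statement above.

Consumed by `TypeICertificateLadderNoTypeIBlowupTypeIMorrey.lean` together with the symmetry-free
quantitative Lemma 3.5 (`scaledEnergy_vertex_le_of_typeI`,
`TypeICertificateLadderNoTypeIBlowupLemma35.lean`) to obtain the Morrey bound of a Type I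
solution uniformly over all centres.
-/

noncomputable section

namespace Summit.NavierStokesRegularity.NavierStokesRegularity.Theorems

open MeasureTheory Set Function Filter Topology TopologicalSpace Metric
open Literature.Analysis.FluidPDE Literature.Analysis.FluidPDE.SereginSverak2009
open Literature.Barriers.NavierStokesRegularity
open scoped NNReal ENNReal

/-- **The eventual Type I rate on a final window.** `IsTypeIBlowup u T` (`‖u(t, x)‖ ≤ C'/√(T−t)`
eventually as `t ↑ T`) and `0 < T` give `C ≥ 0` and `0 < δ ≤ T` with `√(T − t)‖u(t, x)‖ ≤ C`
for all `T − δ < t < T` and all `x`. [folklore] -/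
theorem exists_typeI_rate_window {T : ℝ} (hT : 0 < T)
    {u : ℝ → EuclideanSpace ℝ (Fin 3) → EuclideanSpace ℝ (Fin 3)} (hI : IsTypeIBlowup u T) :
    ∃ C δ : ℝ, 0 ≤ C ∧ 0 < δ ∧ δ ≤ T ∧
      ∀ t ∈ Ioo (T - δ) T, ∀ x, Real.sqrt (T - t) * ‖u t x‖ ≤ C := by
  obtain ⟨C, hC⟩ := hI
  obtain ⟨T₁, hT₁T, hT₁⟩ := mem_nhdsLT_iff_exists_Ioo_subset.1 hC
  refine ⟨max C 0, min (T - T₁) T, le_max_right _ _, lt_min (sub_pos.2 hT₁T) hT, min_le_right _ _,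
    fun t ht x => ?_⟩
  have hδT₁ : min (T - T₁) T ≤ T - T₁ := min_le_left _ _
  have hpos : 0 < Real.sqrt (T - t) := Real.sqrt_pos.2 (sub_pos.2 ht.2)
  have h1 : ‖u t x‖ ≤ C / Real.sqrt (T - t) := hT₁ ⟨by linarith [ht.1], ht.2⟩ x
  calc Real.sqrt (T - t) * ‖u t x‖ ≤ Real.sqrt (T - t) * (C / Real.sqrt (T - t)) :=
        mul_le_mul_of_nonneg_left h1 hpos.le
    _ = C := mul_div_cancel₀ C hpos.ne'
    _ ≤ max C 0 := le_max_left _ _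

/-- **The unit-cylinder zoom at an arbitrary centre, with centre-independent data bounds.**
Setting: `ν > 0`, `T > 0`, `(u, p)` classical on `[0, T)`, Leray–Hopf on `[0, T)`; the Type I
rate `√(T − t)‖u(t, x)‖ ≤ C` on the window `(T − δ, T)`, `δ ≤ T`; a scale
`R > 0` with `4 (R²/ν) ≤ δ`; a top time `T'` with `T − δ/2 < T' ≤ T`; a centre `x₁`. With
`α = R/ν`, `β = R²/ν`, `q = p − (p(·, 0) − p̃[u](0))` (Tao's gauge) and the zooms
`w = α • stPull β R T' x₁ u`, `π = α² • stPull β R T' x₁ q`, `G = (αR) • stPull β R T' x₁ ∇u`: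
(i) `(w, π)` is a suitable weak solution of the unit-viscosity system in `Q(0, 1)`
(`IsSuitableWeakSolutionOn.stRescale` of the gauged suitability below `T`,
`SereginSverak2002.isSuitableWeakSolutionOn_gauge_of_classical`); (ii) `w ∈ L³(Q(0, 1))`;
(iii) `G` is a weak spatial gradient of `w` on `Q(0, 1)`; (iv) `√(-s)‖w(s, y)‖ ≤ αC/√β` a.e. on
`Q(0, 1)` (as `√(T' − t) ≤ √(T − t)`); (v) `A(0, 3/4; w) ≤ (4/3) α² R⁻³ · 2E(u₀)` (energy
inequality), `E(0, 3/4; G) ≤ (4/3) (αR)² (βR³)⁻¹ ∫∫_{(0,T)×ℝ³} |∇u|²`,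
`D(0, 1; π) ≤ (α²)^{3/2} (βR³)⁻¹ ∫∫_{(0,T)×ℝ³} |q|^{3/2}` — bounds independent of `(T', x₁)`.
[cite: SereginSverak2009, §3 (the functionals A, E, D and the unit cylinder); Tao2011, Lemma 4.1 (i)] -/
theorem zoom_unitCyl_data {ν T : ℝ} (hν : 0 < ν) (hT : 0 < T)
    {u : ℝ → EuclideanSpace ℝ (Fin 3) → EuclideanSpace ℝ (Fin 3)} {p : ℝ → EuclideanSpace ℝ (Fin 3) → ℝ}
    (hsol : IsClassicalNSSolutionOn (Ico 0 T) ν 0 u p) (hLH : IsLerayHopfOn T ν 0 (u 0) u)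
    {C δ : ℝ} (hδT : δ ≤ T)
    (hrate : ∀ t ∈ Ioo (T - δ) T, ∀ x, Real.sqrt (T - t) * ‖u t x‖ ≤ C)
    {R : ℝ} (hR : 0 < R) (hRδ : 4 * (R ^ 2 / ν) ≤ δ)
    {T' : ℝ} (hT'1 : T - δ / 2 < T') (hT'2 : T' ≤ T) (x₁ : EuclideanSpace ℝ (Fin 3)) :
    IsSuitableWeakSolutionOn (parCylOpens 0 1) 1 0 ((R / ν) • stPull (R ^ 2 / ν) R T' x₁ u)
        ((R / ν) ^ 2 • stPull (R ^ 2 / ν) R T' x₁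
          fun t x => p t x - (p t 0 - normalisedPressure (u t) 0)) ∧
      (∫⁻ z in parCyl 0 1, ‖((R / ν) • stPull (R ^ 2 / ν) R T' x₁ u) z.1 z.2‖ₑ ^ (3 : ℕ) < ∞) ∧
      HasWeakSpatialGradientOn (parCylOpens 0 1) ((R / ν) • stPull (R ^ 2 / ν) R T' x₁ u)
        (((R / ν) * R) • stPull (R ^ 2 / ν) R T' x₁ fun t x => fderiv ℝ (u t) x) ∧
      (∀ᵐ z ∂(volume.restrict (parCyl 0 1)),
        Real.sqrt (-z.1) * ‖((R / ν) • stPull (R ^ 2 / ν) R T' x₁ u) z.1 z.2‖ ≤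
          (R / ν) / Real.sqrt (R ^ 2 / ν) * C) ∧
      energyA 0 (3 / 4) ((R / ν) • stPull (R ^ 2 / ν) R T' x₁ u) ≤
        (ENNReal.ofReal (3 / 4))⁻¹ * (‖(R / ν : ℝ)‖ₑ ^ 2 * (ENNReal.ofReal (R ^ 3)⁻¹ *
          ENNReal.ofReal (2 * VectorCalculus.kineticEnergy (u 0)))) ∧
      dissipationE 0 (3 / 4) (((R / ν) * R) • stPull (R ^ 2 / ν) R T' x₁ fun t x => fderiv ℝ (u t) x) ≤
        (ENNReal.ofReal (3 / 4))⁻¹ * (ENNReal.ofReal (((R / ν) * R) ^ 2) *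
          ENNReal.ofReal ((R ^ 2 / ν) * R ^ 3)⁻¹ *
          ∫⁻ z in Ioo 0 T ×ˢ (univ : Set (EuclideanSpace ℝ (Fin 3))),
            ENNReal.ofReal (frobeniusNormSq (fderiv ℝ (u z.1) z.2))) ∧
      pressureD 0 1 ((R / ν) ^ 2 • stPull (R ^ 2 / ν) R T' x₁
          fun t x => p t x - (p t 0 - normalisedPressure (u t) 0)) ≤
        ‖((R / ν) ^ 2 : ℝ)‖ₑ ^ (3 / 2 : ℝ) * ENNReal.ofReal ((R ^ 2 / ν) * R ^ 3)⁻¹ *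
          ∫⁻ z in Ioo 0 T ×ˢ (univ : Set (EuclideanSpace ℝ (Fin 3))),
            ‖p z.1 z.2 - (p z.1 0 - normalisedPressure (u z.1) 0)‖ₑ ^ (3 / 2 : ℝ) := by
  -- scales
  set α : ℝ := R / ν with hα
  set β : ℝ := R ^ 2 / ν with hβdef
  have hαpos : 0 < α := by positivity
  have hβpos : 0 < β := by positivity
  have hβeq : β = α * R := by rw [hβdef, hα]; field_simp
  have hβδ : 4 * β ≤ δ := hRδ
  -- the gauged pressure and the physical image of the unit cylinder
  set q : ℝ → EuclideanSpace ℝ (Fin 3) → ℝ := fun t x => p t x - (p t 0 - normalisedPressure (u t) 0)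
    with hq
  have hPopen := isOpen_image_stAffine_ssCylinder (T := T') (x₀ := x₁) hβpos.ne' hR.ne'
  set PO : Opens (ℝ × EuclideanSpace ℝ (Fin 3)) := ⟨stAffine β R T' x₁ '' ssCylinder, hPopen⟩ with hPO
  have hPwin : (PO : Set (ℝ × EuclideanSpace ℝ (Fin 3))) ⊆
      Ioo (T' - β) T' ×ˢ (univ : Set (EuclideanSpace ℝ (Fin 3))) := by
    rintro _ ⟨z, hz, rfl⟩
    obtain ⟨hs, -, -⟩ := mem_ssCylinder.1 hz
    refine ⟨⟨?_, ?_⟩, mem_univ _⟩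
    · show T' - β < T' + β * z.1
      nlinarith [hs.1]
    · show T' + β * z.1 < T'
      nlinarith [hs.2]
  have hwinslab : Ioo (T' - β) T' ×ˢ (univ : Set (EuclideanSpace ℝ (Fin 3))) ⊆
      Ioo 0 T ×ˢ (univ : Set (EuclideanSpace ℝ (Fin 3))) :=
    prod_mono (Ioo_subset_Ioo (by linarith) hT'2) Subset.rfl
  have hPslab : (PO : Set (ℝ × EuclideanSpace ℝ (Fin 3))) ⊆ Ioo 0 T ×ˢ (univ : Set (EuclideanSpace ℝ (Fin 3))) :=
    hPwin.trans hwinslab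
  have hpre : stAffine β R T' x₁ ⁻¹' (PO : Set (ℝ × EuclideanSpace ℝ (Fin 3))) = ssCylinder :=
    preimage_image_eq _ (injective_stAffine hβpos.ne' hR.ne' T' x₁)
  have hpreO : stPreimage β R T' x₁ PO = parCylOpens 0 1 := by
    rw [stPreimage_image_ssCylinder hβpos.ne' hR.ne' hPopen, ssCylinderOpens_eq_parCylOpens]
  have hvisc : α * ν / R = 1 := by rw [hα, div_mul_cancel₀ R hν.ne', div_self hR.ne']
  -- (i) suitability of the zoom in `Q(0,1)`
  have hsuit : IsSuitableWeakSolutionOn (parCylOpens 0 1) 1 0 (α • stPull β R T' x₁ u)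
      (α ^ 2 • stPull β R T' x₁ q) := by
    have h0 := (SereginSverak2002.isSuitableWeakSolutionOn_gauge_of_classical hν hT hsol hLH PO
      hPslab).stRescale hαpos hR hβeq T' x₁
    have hforce : ((α ^ 2 * R) • stPull β R T' x₁
        (0 : ℝ → EuclideanSpace ℝ (Fin 3) → EuclideanSpace ℝ (Fin 3))) = 0 := by
      funext s y; simp [stPull]
    rw [hvisc, hforce, hpreO] at h0
    exact h0
  -- (ii) `w ∈ L³(Q(0,1))`
  have hL3 : ∫⁻ z in parCyl 0 1, ‖(α • stPull β R T' x₁ u) z.1 z.2‖ₑ ^ (3 : ℕ) < ∞ := by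
    rw [← ssCylinder_eq_parCyl, ← hpre, setLIntegral_enorm_pow_stRescale hβpos hR T' x₁ α u _ 3]
    refine ENNReal.mul_lt_top
      (ENNReal.mul_lt_top (ENNReal.pow_lt_top enorm_lt_top) ENNReal.ofReal_lt_top) ?_
    exact lt_of_le_of_lt (lintegral_mono_set hPslab)
      (SereginSverak2002.lintegral_slab_enorm_pow_three_lt_top hν hLH)
  -- (iii) the zoomed classical gradient
  have hGu : HasWeakSpatialGradientOn PO u fun t x => fderiv ℝ (u t) x :=
    hasWeakSpatialGradientOn_of_contDiffOn isOpen_Ioo hPslab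
      ((SereginSverak2002.classical_Ioo hsol).smooth_velocity.of_le (by norm_cast))
  have hGv : HasWeakSpatialGradientOn (parCylOpens 0 1) (α • stPull β R T' x₁ u)
      ((α * R) • stPull β R T' x₁ fun t x => fderiv ℝ (u t) x) := by
    rw [← hpreO]
    exact hGu.stRescale α hβpos hR T' x₁
  -- (iv) the Type I rate in the rescaled time (top time `T' ≤ T`)
  have htypeI : ∀ᵐ z ∂(volume.restrict (parCyl 0 1)),
      Real.sqrt (-z.1) * ‖(α • stPull β R T' x₁ u) z.1 z.2‖ ≤ α / Real.sqrt β * C := by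
    rw [← ssCylinder_eq_parCyl]
    refine (ae_restrict_mem isOpen_ssCylinder.measurableSet).mono ?_
    intro z hz
    obtain ⟨hs, -, -⟩ := mem_ssCylinder.1 hz
    have hτ : T' + β * z.1 ∈ Ioo (T - δ) T := by
      constructor
      · nlinarith [hs.1]
      · have : T' + β * z.1 < T' := by nlinarith [hs.2]
        linarith
    have hr := hrate _ hτ (x₁ + R • z.2)
    -- `√(T' - t) ≤ √(T - t)`
    have hmono : Real.sqrt (T' - (T' + β * z.1)) ≤ Real.sqrt (T - (T' + β * z.1)) :=
      Real.sqrt_le_sqrt (by linarith)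
    have hr' : Real.sqrt (T' - (T' + β * z.1)) * ‖u (T' + β * z.1) (x₁ + R • z.2)‖ ≤ C :=
      (mul_le_mul_of_nonneg_right hmono (norm_nonneg _)).trans hr
    have hsq : Real.sqrt (T' - (T' + β * z.1)) = Real.sqrt β * Real.sqrt (-z.1) := by
      rw [show T' - (T' + β * z.1) = β * (-z.1) by ring, Real.sqrt_mul hβpos.le]
    rw [hsq] at hr'
    have hsβ : 0 < Real.sqrt β := Real.sqrt_pos.2 hβpos
    rw [smul_stPull_apply, norm_smul, Real.norm_of_nonneg hαpos.le]
    calc Real.sqrt (-z.1) * (α * ‖u (T' + β * z.1) (x₁ + R • z.2)‖)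
        = α / Real.sqrt β * (Real.sqrt β * Real.sqrt (-z.1) * ‖u (T' + β * z.1) (x₁ + R • z.2)‖) := by
          field_simp
      _ ≤ α / Real.sqrt β * C := mul_le_mul_of_nonneg_left hr' (by positivity)
  -- (v-a) the energy `A(0, 3/4; w)`
  have hA : energyA 0 (3 / 4) (α • stPull β R T' x₁ u) ≤
      (ENNReal.ofReal (3 / 4))⁻¹ * (‖α‖ₑ ^ 2 * (ENNReal.ofReal (R ^ 3)⁻¹ *
        ENNReal.ofReal (2 * VectorCalculus.kineticEnergy (u 0)))) := by
    unfold energyA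
    refine essSup_le_of_ae_le _ ((ae_restrict_mem measurableSet_Ioo).mono fun s hs => ?_)
    simp only [Prod.fst_zero, Prod.snd_zero, zero_sub] at hs ⊢
    refine mul_le_mul' le_rfl ?_
    have hτ : T' + β * s ∈ Icc 0 T := by
      constructor
      · nlinarith [hs.1]
      · nlinarith [hs.2]
    have e : ∀ y : EuclideanSpace ℝ (Fin 3), ‖(α • stPull β R T' x₁ u) s y‖ₑ ^ 2 =
        ‖α‖ₑ ^ 2 * ‖u (T' + β * s) (x₁ + R • y)‖ₑ ^ 2 := by
      intro y
      rw [smul_stPull_apply, enorm_smul, mul_pow]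
    simp only [e]
    rw [lintegral_const_mul' _ _ (by simp)]
    refine mul_le_mul' le_rfl ((setLIntegral_le_lintegral _ _).trans ?_)
    rw [lintegral_comp_space_affine hR x₁ (fun x => ‖u (T' + β * s) x‖ₑ ^ 2),
      finrank_euclideanSpace_fin]
    exact mul_le_mul' le_rfl (SereginSverak2002.eEnergy_le hν.le hLH hτ)
  -- (v-b) the dissipation `E(0, 3/4; G)`
  have hE : dissipationE 0 (3 / 4) ((α * R) • stPull β R T' x₁ fun t x => fderiv ℝ (u t) x) ≤
      (ENNReal.ofReal (3 / 4))⁻¹ * (ENNReal.ofReal ((α * R) ^ 2) * ENNReal.ofReal (β * R ^ 3)⁻¹ *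
        ∫⁻ z in Ioo 0 T ×ˢ (univ : Set (EuclideanSpace ℝ (Fin 3))),
          ENNReal.ofReal (frobeniusNormSq (fderiv ℝ (u z.1) z.2))) := by
    unfold dissipationE
    refine mul_le_mul' le_rfl ?_
    have hsub : parCyl (0 : ℝ × EuclideanSpace ℝ (Fin 3)) (3 / 4) ⊆ parCyl 0 1 :=
      parCyl_mono 0 (by norm_num) (by norm_num)
    refine (lintegral_mono_set hsub).trans ?_
    rw [← ssCylinder_eq_parCyl, ← hpre, setLIntegral_frobeniusNormSq_stRescale hβpos hR T' x₁ (α * R),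
      finrank_euclideanSpace_fin]
    exact mul_le_mul' le_rfl (lintegral_mono_set hPslab)
  -- (v-c) the pressure `D(0, 1; π)`
  have hD : pressureD 0 1 (α ^ 2 • stPull β R T' x₁ q) ≤
      ‖(α ^ 2 : ℝ)‖ₑ ^ (3 / 2 : ℝ) * ENNReal.ofReal (β * R ^ 3)⁻¹ *
        ∫⁻ z in Ioo 0 T ×ˢ (univ : Set (EuclideanSpace ℝ (Fin 3))),
          ‖p z.1 z.2 - (p z.1 0 - normalisedPressure (u z.1) 0)‖ₑ ^ (3 / 2 : ℝ) := by
    unfold pressureD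
    rw [ENNReal.ofReal_one, one_pow, inv_one, one_mul, ← ssCylinder_eq_parCyl, ← hpre,
      setLIntegral_enorm_rpow_stRescale hβpos hR T' x₁ (α ^ 2) q _ (by norm_num),
      finrank_euclideanSpace_fin]
    exact mul_le_mul' le_rfl (lintegral_mono_set hPslab)
  exact ⟨hsuit, hL3, hGv, htypeI, hA, hE, hD⟩

end Summit.NavierStokesRegularity.NavierStokesRegularity.Theorems

end
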